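import Literature.MathematicalPhysics.QuantumFieldTheory.Balaban1983to89.B9Eq369CurvFormL2

/-!
# `Balaban1983to89.B9Eq369CurvOpSupLetter` — T. Bałaban, *Propagators for lattice gauge theories in a background field*, Commun. Math. Phys. **99**
# (1985) 389–434 [Balaban1985BackgroundPropagators] (3.69) p. 404 with (3.10) p. 392, (3.11) p. 392, (3.35) p. 396: **THE `L^∞ → L^∞` LETTER OF THE
# CURVATURE PART — `‖(Δ′g)(b)‖ ≤ p_K·sup_{b′}‖g(b′)‖`** for the Riesz operator `curvOp` on the chain's `L²` bond space, `p_K = 768·|DirPair d|·M_τ·M_φ²·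
# (‖η^d‖∕c₀)·‖η⁻¹‖²·δ` — print's (3.69) *«|(Δ′(U′U)A′)(b)| ≤ O(1)(L^jη)⁻²e^{…}|A′|»* in the VALUE (sup-norm) currency, by LOCALITY of the form (3.10)

statement-level skeleton of published theorems with citation tags; proofs where landed; nothing here is a claim about the Yang–Mills mass gap

CITATION HEADER (lean-in-tree rule).  Audit cell `pub-balaban`, sub-cell `t4`, BINDER row NE9; filed by the NE9 BINDER-row OWNER lineage
`b2b-balaban-t4-ne9-p1` (gen 93).  Imports `B9Eq369CurvFormL2` only (this lineage g92: `norm_plaquette_term_le`, `sum_plaq_base_le`, `sum_plaq_shift_le`;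
through it `B9Eq310HessianOperator`: `curvOp`, `inner_curvOp`, `toAlg`; `B9Eq310DeltaPrime`: `curvForm`, `curvBlock₁`, `curvBlock₂`).  Sources READ first-hand
(`paper:balaban1985-cmp99-background-propagators`, journal page = PDF page + 388): p. 404 (3.69) *«From the formula (3.10) it follows that Δ′(U′U) is a small,
bounded operator … |(Δ′(U′U)A′)(b)| ≤ O(1)C(L^jη)⁻² …»*; p. 392 (3.10)–(3.11).  The tree has the abstract-model sup bound `B9Eq310Hermitian.norm_deltaPrimeOp_le`
(other carrier) and the `L²` sizes `B9Eq369CurvFormL2` (g92); the POINTWISE letter for the chain's Riesz operator `curvOp` — the `(PΔ′)` hypothesis `hPΔ` of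
this lineage's (I0) `B9Eq326LocalPartSupBound.norm_localInv_apply_le` (VALUE row of `A₀⁻¹`) and of the bootstrap rows — is this file, WITHOUT an explicit
kernel: test `Δ′g` against the one-bond function `δ_b^w` and use the per-plaquette bound of the form (locality).

WHAT IS PROVED (sorry-free; proof lane — no `def`; [folklore]).  Letters DISPLAYED as in `B9Eq369CurvFormL2` (`hτ`, `hU`, `hRe`, `hIm`, `hφ`, `hstar`).
* §1 `edgeSum_le_four_mul` (`E_B(p) ≤ 4M` for `‖B‖_∞ ≤ M`), `sum_edgeSum_le` (`Σ_p E_A(p) ≤ 4|DirPair d|·Σ_b‖A(b)‖`), **`norm_curvForm_le_l1_linf_local`** ∕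
  **`norm_curvForm_le_l1_linf`**: `‖curvForm τ η U A B‖ ≤ ‖η^d‖·48M_τδ‖η⁻¹‖²·(4|DirPair d|·Σ_b‖A(b)‖)·(4M)` — the `L¹ × L^∞` size of (3.10), `M` a bound
  of `B` on the plaquettes where `A` is seen (local) ∕ everywhere (global).
* §2 on `BondL2K`: `inner_single_left` (`⟪δ_b^w, v⟫ = c₀⟪w, v(b)⟫`), `sum_norm_star_toAlg_single_le` (`Σ_{b′}‖(Φδ_b^w)*(b′)‖ ≤ M_φ‖w‖`), `star_toAlg_single_eq_zero`,
  `norm_toAlg_le_sup`; THE LETTERS **`norm_apply_curvOp_le_local`** `(g) (b) (hM : ‖g‖ ≤ M on the bonds of every plaquette through b) : ‖(Δ′g)(b)‖ ≤ p_K·M`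
  (print's «supremum over bonds belonging to one of the plaquettes containing b» — the form WEIGHTED sup-currency rows need) and **`norm_apply_curvOp_le_sup`**
  `(g) (b) : ‖(Δ′g)(b)‖ ≤ p_K·⨆_{b′}‖g(b′)‖` — EXACTLY the `hPΔ` shape of (I0), `p′_∞ := p_K = O(α₀)` on (3.35).
HONEST SCOPE.  Crude constants; the model letters stay hypotheses; nothing of [B9] Thm 3.1∕3.3∕3.11 asserted; «NE9 ⇐ the named binders»; NE9 NOT PRINTED ∕ NOT
PROVED; row WALLED ON A MODEL (O-NE9-1; #5 UNRULED); spine PROVED 0∕9; rung (B)+1 on a finite T⁴ — NOT infinite volume, NOT mass gap, NOT BetaPertH, NOT Clay.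
HONEST DEPENDENCY: continuum YM on T⁴ ⇐ BetaPertH ∧ nine spine estimates (0/9 proved); BetaPertH ⇐ (D1) ∧ (D4) ∧ CAP+tail.  NEW file; nothing modified.
Net new unproved facts: 0.
-/

noncomputable section

open scoped InnerProductSpace ComplexConjugate BigOperators
open Finset

namespace Literature.MathematicalPhysics.QuantumFieldTheory.Balaban1983to89.B9Eq369CurvOpSupLetter

open B4Sect5Torus (TSite)
open B9SectCLatticeCarrier (Bond DirPair bpos btgt shift)
open B9Eq311L2Pairing (WL2)
open B11Eq103H1Complex (BondL2K)
open B9Eq310DeltaPrime (reHol imHol curvBlock₁ curvBlock₂ curvForm curvForm_apply)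
open B9Eq310HessianOperator (curvOp inner_curvOp toAlg)
open B9Eq369CurvFormL2 (norm_plaquette_term_le sum_plaq_base_le sum_plaq_shift_le)

/-! ## §1 The `L¹ × L^∞` size of the form (3.10) -/

section Form

variable {d : ℕ} {Pd : Fin d → ℕ} {𝔸 : Type*} [NormedRing 𝔸] [NormedAlgebra ℂ 𝔸] (τ : 𝔸 →ₗ[ℂ] ℂ) {Mτ : ℝ}
  (hτ : ∀ X Y : 𝔸, ‖τ (X * Y)‖ ≤ Mτ * ‖X‖ * ‖Y‖) (hMτ : 0 ≤ Mτ)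
  (η : ℝ) (U : Bond d Pd → 𝔸ˣ) (hU : ∀ b, ‖(U b : 𝔸)‖ ≤ 1 ∧ ‖(((U b)⁻¹ : 𝔸ˣ) : 𝔸)‖ ≤ 1) {δ : ℝ} (hδ : 0 ≤ δ)
  (hRe : ∀ p : B9SectCLatticeCarrier.Plaq d Pd, ‖reHol U p - 1‖ ≤ δ) (hIm : ∀ p : B9SectCLatticeCarrier.Plaq d Pd, ‖imHol U p‖ ≤ δ)

omit [NormedAlgebra ℂ 𝔸] in
/-- `E_B(p) ≤ 4M` when `‖B(b)‖ ≤ M` everywhere. [folklore] [cite: Balaban1985BackgroundPropagators, (3.2) p.390] -/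
theorem edgeSum_le_four_mul (B : Bond d Pd → 𝔸) {M : ℝ} (hM : ∀ b, ‖B b‖ ≤ M) (x : TSite d Pd) (q : DirPair d) :
    ‖B (x, q.1.1)‖ + ‖B (x, q.1.2)‖ + ‖B (shift q.1.1 x, q.1.2)‖ + ‖B (shift q.1.2 x, q.1.1)‖ ≤ 4 * M := by
  linarith [hM (x, q.1.1), hM (x, q.1.2), hM (shift q.1.1 x, q.1.2), hM (shift q.1.2 x, q.1.1)]

omit [NormedAlgebra ℂ 𝔸] in
/-- **`Σ_p E_A(p) ≤ 4·|DirPair d|·Σ_b‖A(b)‖`** (the two countings of `B9Eq369CurvFormL2`). [folklore] [cite: Balaban1985BackgroundPropagators, (3.2) p.390] -/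
theorem sum_edgeSum_le (A : Bond d Pd → 𝔸) :
    ∑ p : B9SectCLatticeCarrier.Plaq d Pd,
        (‖A (p.1, p.2.1.1)‖ + ‖A (p.1, p.2.1.2)‖ + ‖A (shift p.2.1.1 p.1, p.2.1.2)‖ + ‖A (shift p.2.1.2 p.1, p.2.1.1)‖) ≤
      4 * Fintype.card (DirPair d) * ∑ b : Bond d Pd, ‖A b‖ := by
  have h1 := sum_plaq_base_le (Pd := Pd) (fun b => ‖A b‖) (fun b => norm_nonneg _) (fun q => q.1.1)
  have h2 := sum_plaq_base_le (Pd := Pd) (fun b => ‖A b‖) (fun b => norm_nonneg _) (fun q => q.1.2)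
  have h3 := sum_plaq_shift_le (Pd := Pd) (fun b => ‖A b‖) (fun b => norm_nonneg _) (fun q => q.1.2) (fun q => q.1.1)
  have h4 := sum_plaq_shift_le (Pd := Pd) (fun b => ‖A b‖) (fun b => norm_nonneg _) (fun q => q.1.1) (fun q => q.1.2)
  simp only [Finset.sum_add_distrib]
  linarith

include hτ hMτ hU hδ hRe hIm in
/-- **THE `L¹ × L^∞` SIZE OF (3.10), LOCAL FORM**: if on every plaquette `E_A(p)·E_B(p) ≤ E_A(p)·4M` (i.e. `E_B(p) ≤ 4M` wherever `A` is seen), then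
`‖curvForm τ η U A B‖ ≤ ‖η^d‖·48M_τδ‖η⁻¹‖²·(4|DirPair d|·Σ_b‖A(b)‖)·(4M)` — `norm_plaquette_term_le` summed (range-1 locality of (3.10)).
[cite: Balaban1985BackgroundPropagators, (3.10) p.392, (3.69) p.404, (3.35) p.396] -/
theorem norm_curvForm_le_l1_linf_local (A B : Bond d Pd → 𝔸) {M : ℝ} (hM0 : 0 ≤ M)
    (hloc : ∀ (x : TSite d Pd) (q : DirPair d),
      (‖A (x, q.1.1)‖ + ‖A (x, q.1.2)‖ + ‖A (shift q.1.1 x, q.1.2)‖ + ‖A (shift q.1.2 x, q.1.1)‖) *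
          (‖B (x, q.1.1)‖ + ‖B (x, q.1.2)‖ + ‖B (shift q.1.1 x, q.1.2)‖ + ‖B (shift q.1.2 x, q.1.1)‖) ≤
        (‖A (x, q.1.1)‖ + ‖A (x, q.1.2)‖ + ‖A (shift q.1.1 x, q.1.2)‖ + ‖A (shift q.1.2 x, q.1.1)‖) * (4 * M)) :
    ‖curvForm τ η U A B‖ ≤ (‖((η : ℂ)) ^ d‖ * (48 * Mτ * δ * ‖((η : ℂ))⁻¹‖ ^ 2)) * (4 * Fintype.card (DirPair d) * ∑ b : Bond d Pd, ‖A b‖) * (4 * M) := by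
  set K : ℝ := ‖((η : ℂ)) ^ d‖ * (48 * Mτ * δ * ‖((η : ℂ))⁻¹‖ ^ 2) with hK
  have hK0 : 0 ≤ K := by positivity
  set EA : B9SectCLatticeCarrier.Plaq d Pd → ℝ := fun p =>
    ‖A (p.1, p.2.1.1)‖ + ‖A (p.1, p.2.1.2)‖ + ‖A (shift p.2.1.1 p.1, p.2.1.2)‖ + ‖A (shift p.2.1.2 p.1, p.2.1.1)‖ with hEA
  have hpt : ∀ p : B9SectCLatticeCarrier.Plaq d Pd, ‖((η : ℂ)) ^ d * (curvBlock₁ τ η U p A B + curvBlock₂ τ η U p A B)‖ ≤ K * (EA p * (4 * M)) := by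
    rintro ⟨x, q⟩
    exact (norm_plaquette_term_le τ hτ hMτ η U hU hδ hRe hIm A B x q).trans (mul_le_mul_of_nonneg_left (hloc x q) hK0)
  have hS := sum_edgeSum_le (Pd := Pd) A
  rw [curvForm_apply]
  calc _ ≤ ∑ p : B9SectCLatticeCarrier.Plaq d Pd, K * (EA p * (4 * M)) := (norm_sum_le _ _).trans (Finset.sum_le_sum fun p _ => hpt p)
    _ = K * (4 * M) * ∑ p : B9SectCLatticeCarrier.Plaq d Pd, EA p := by rw [Finset.mul_sum]; exact Finset.sum_congr rfl fun p _ => by ring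
    _ ≤ K * (4 * M) * (4 * Fintype.card (DirPair d) * ∑ b : Bond d Pd, ‖A b‖) := mul_le_mul_of_nonneg_left hS (by positivity)
    _ = _ := by ring

include hτ hMτ hU hδ hRe hIm in
/-- **THE `L¹ × L^∞` SIZE OF (3.10)**: `‖curvForm τ η U A B‖ ≤ ‖η^d‖·48M_τδ‖η⁻¹‖²·(4|DirPair d|·Σ_b‖A(b)‖)·(4M)` for `‖B(b)‖ ≤ M` (`M ≥ 0`).
[cite: Balaban1985BackgroundPropagators, (3.10) p.392, (3.69) p.404, (3.35) p.396] -/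
theorem norm_curvForm_le_l1_linf (A B : Bond d Pd → 𝔸) {M : ℝ} (hM0 : 0 ≤ M) (hM : ∀ b, ‖B b‖ ≤ M) :
    ‖curvForm τ η U A B‖ ≤ (‖((η : ℂ)) ^ d‖ * (48 * Mτ * δ * ‖((η : ℂ))⁻¹‖ ^ 2)) * (4 * Fintype.card (DirPair d) * ∑ b : Bond d Pd, ‖A b‖) * (4 * M) :=
  norm_curvForm_le_l1_linf_local τ hτ hMτ η U hU hδ hRe hIm A B hM0 fun x q =>
    mul_le_mul_of_nonneg_left (edgeSum_le_four_mul B hM x q) (by positivity)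

end Form

/-! ## §2 On the `L²` bond space: the one-bond test function and the pointwise letter -/

section L2

variable {d : ℕ} {Pd : Fin d → ℕ} {𝔸 : Type*} [NormedRing 𝔸] [StarRing 𝔸] [NormedAlgebra ℂ 𝔸] [StarModule ℂ 𝔸]
  {W : Type*} [NormedAddCommGroup W] [InnerProductSpace ℂ W] [FiniteDimensional ℂ W] (φ : W ≃ₗ[ℂ] 𝔸) {Mφ : ℝ}
  (hφ : ∀ w, ‖φ w‖ ≤ Mφ * ‖w‖) (hMφ : 0 ≤ Mφ) (hstar : ∀ X : 𝔸, ‖star X‖ ≤ ‖X‖)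
  {c₀ : ℝ} [Fact (0 < c₀)] (τ : 𝔸 →ₗ[ℂ] ℂ) {Mτ : ℝ} (hτ : ∀ X Y : 𝔸, ‖τ (X * Y)‖ ≤ Mτ * ‖X‖ * ‖Y‖) (hMτ : 0 ≤ Mτ)
  (η : ℝ) (U : Bond d Pd → 𝔸ˣ) (hU : ∀ b, ‖(U b : 𝔸)‖ ≤ 1 ∧ ‖(((U b)⁻¹ : 𝔸ˣ) : 𝔸)‖ ≤ 1) {δ : ℝ} (hδ : 0 ≤ δ)
  (hRe : ∀ p : B9SectCLatticeCarrier.Plaq d Pd, ‖reHol U p - 1‖ ≤ δ) (hIm : ∀ p : B9SectCLatticeCarrier.Plaq d Pd, ‖imHol U p‖ ≤ δ)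

omit [StarRing 𝔸] [StarModule ℂ 𝔸] [FiniteDimensional ℂ W] in
/-- **The one-bond test function**: for `δ` with `δ(b) = w`, `δ(b′) = 0` otherwise, `⟪δ, v⟫ = c₀·⟪w, v(b)⟫`. [folklore]
[cite: Balaban1985BackgroundPropagators, (3.11) p.392] -/
theorem inner_single_left [DecidableEq (Bond d Pd)] (b : Bond d Pd) (w : W) (δv v : BondL2K ℂ d Pd c₀ W)
    (hδ : ∀ b', WL2.equiv ℂ (fun _ : Bond d Pd => c₀) W δv b' = (Pi.single b w : Bond d Pd → W) b') :
    ⟪δv, v⟫_ℂ = (c₀ : ℂ) * ⟪w, WL2.equiv ℂ (fun _ : Bond d Pd => c₀) W v b⟫_ℂ := by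
  rw [WL2.inner_def, Finset.sum_eq_single b (fun b' _ hb' => by rw [hδ, Pi.single_eq_of_ne hb', inner_zero_left, mul_zero])
    (fun h => absurd (Finset.mem_univ b) h), hδ, Pi.single_eq_same]
  rfl

omit [StarModule ℂ 𝔸] [FiniteDimensional ℂ W] [Fact (0 < c₀)] in
include hφ hstar in
/-- … and its starred algebra reading has `Σ_{b′}‖(Φδ)*(b′)‖ ≤ M_φ‖w‖`. [folklore] [cite: Balaban1985Averaging, (18) p.21] -/
theorem sum_norm_star_toAlg_single_le [DecidableEq (Bond d Pd)] (b : Bond d Pd) (w : W)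
    (δv : BondL2K ℂ d Pd c₀ W) (hδ : ∀ b', WL2.equiv ℂ (fun _ : Bond d Pd => c₀) W δv b' = (Pi.single b w : Bond d Pd → W) b') :
    ∑ b' : Bond d Pd, ‖star (toAlg φ δv) b'‖ ≤ Mφ * ‖w‖ := by
  have hpt : ∀ b', star (toAlg φ δv) b' = star (φ ((Pi.single b w : Bond d Pd → W) b')) := fun b' => by
    show star (φ (WL2.equiv ℂ (fun _ : Bond d Pd => c₀) W δv b')) = _; rw [hδ]
  rw [Finset.sum_eq_single b (fun b' _ hb' => by rw [hpt, Pi.single_eq_of_ne hb', map_zero, star_zero, norm_zero])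
    (fun h => absurd (Finset.mem_univ b) h), hpt, Pi.single_eq_same]
  exact (hstar _).trans (hφ w)

omit [StarRing 𝔸] [StarModule ℂ 𝔸] [FiniteDimensional ℂ W] [Fact (0 < c₀)] in
include hφ hMφ in
/-- `‖(Φg)(b)‖ ≤ M_φ·sup_{b′}‖g(b′)‖`. [folklore] [cite: Balaban1985Averaging, (18) p.21] -/
theorem norm_toAlg_le_sup (g : BondL2K ℂ d Pd c₀ W) (b : Bond d Pd) :
    ‖toAlg φ g b‖ ≤ Mφ * ⨆ b' : Bond d Pd, ‖WL2.equiv ℂ (fun _ : Bond d Pd => c₀) W g b'‖ := by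
  have hle : ‖WL2.equiv ℂ (fun _ : Bond d Pd => c₀) W g b‖ ≤ ⨆ b' : Bond d Pd, ‖WL2.equiv ℂ (fun _ : Bond d Pd => c₀) W g b'‖ :=
    le_ciSup (f := fun b' : Bond d Pd => ‖WL2.equiv ℂ (fun _ : Bond d Pd => c₀) W g b'‖) (Set.finite_range _).bddAbove b
  exact (hφ _).trans (mul_le_mul_of_nonneg_left hle hMφ)

omit [StarModule ℂ 𝔸] [FiniteDimensional ℂ W] [Fact (0 < c₀)] in
/-- … and vanishes off `b`: `(Φδ)*(b′) = 0` for `b′ ≠ b`. [folklore] [cite: Balaban1985Averaging, (18) p.21] -/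
theorem star_toAlg_single_eq_zero [DecidableEq (Bond d Pd)] (b : Bond d Pd) (w : W) (δv : BondL2K ℂ d Pd c₀ W)
    (hδ : ∀ b', WL2.equiv ℂ (fun _ : Bond d Pd => c₀) W δv b' = (Pi.single b w : Bond d Pd → W) b') {b' : Bond d Pd} (hb' : b' ≠ b) :
    star (toAlg φ δv) b' = 0 := by
  show star (φ (WL2.equiv ℂ (fun _ : Bond d Pd => c₀) W δv b')) = 0
  rw [hδ, Pi.single_eq_of_ne hb', map_zero, star_zero]

include hφ hMφ hstar hτ hMτ hU hδ hRe hIm in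
/-- **THE `L^∞ → L^∞` LETTER OF `Δ′`, LOCAL FORM: `‖(Δ′g)(b)‖ ≤ p_K·M` whenever `‖g‖ ≤ M` on the bonds of every plaquette containing `b`** (the
four-bond sums `≤ 4M`), `p_K = 768·|DirPair d|·M_τ·M_φ²·(‖η^d‖∕c₀)·‖η⁻¹‖²·δ` — print's (3.69) *«the supremum … is taken over bonds belonging to one of the
plaquettes containing the bond b»*; for WEIGHTED sup-currency consumers (a weight ratio `≤ e^{a}` across one plaquette costs `e^{a}`, not `max_y W`).
METHOD: test `v = Δ′g` against the one-bond function `δ_b^{v(b)}`: `c₀‖v(b)‖² = ⟪δ, v⟫ = curvForm((Φδ)*, Φg)` and `norm_curvForm_le_l1_linf_local`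
(`(Φδ)*` lives on `b`, so only plaquettes through `b` see `Φg`). [cite: Balaban1985BackgroundPropagators, (3.69) p.404, (3.10) p.392, (3.11) p.392, (3.35) p.396] -/
theorem norm_apply_curvOp_le_local (g : BondL2K ℂ d Pd c₀ W) (b : Bond d Pd) {M : ℝ} (hM0 : 0 ≤ M)
    (hM : ∀ (x : TSite d Pd) (q : DirPair d),
      (b = (x, q.1.1) ∨ b = (x, q.1.2) ∨ b = (shift q.1.1 x, q.1.2) ∨ b = (shift q.1.2 x, q.1.1)) →
        ‖WL2.equiv ℂ (fun _ : Bond d Pd => c₀) W g (x, q.1.1)‖ + ‖WL2.equiv ℂ (fun _ : Bond d Pd => c₀) W g (x, q.1.2)‖ +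
            ‖WL2.equiv ℂ (fun _ : Bond d Pd => c₀) W g (shift q.1.1 x, q.1.2)‖ + ‖WL2.equiv ℂ (fun _ : Bond d Pd => c₀) W g (shift q.1.2 x, q.1.1)‖ ≤
          4 * M) :
    ‖WL2.equiv ℂ (fun _ : Bond d Pd => c₀) W (curvOp φ τ η U g) b‖ ≤
      768 * Fintype.card (DirPair d) * Mτ * Mφ ^ 2 * (‖((η : ℂ)) ^ d‖ / c₀) * ‖((η : ℂ))⁻¹‖ ^ 2 * δ * M := by
  classical
  have hc₀ : 0 < c₀ := Fact.out
  set v := curvOp φ τ η U g with hv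
  set w : W := WL2.equiv ℂ (fun _ : Bond d Pd => c₀) W v b with hw
  set K : ℝ := ‖((η : ℂ)) ^ d‖ * (48 * Mτ * δ * ‖((η : ℂ))⁻¹‖ ^ 2) with hK
  have hK0 : 0 ≤ K := by positivity
  -- the one-bond test function `δ_b^w`
  set δv : BondL2K ℂ d Pd c₀ W := (WL2.equiv ℂ (fun _ : Bond d Pd => c₀) W).symm (Pi.single b w) with hδvdef
  have hδv : ∀ b', WL2.equiv ℂ (fun _ : Bond d Pd => c₀) W δv b' = (Pi.single b w : Bond d Pd → W) b' := fun b' => rfl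
  -- `c₀‖w‖² = ⟪δ, v⟫ = curvForm((Φδ)*, Φg)`, bounded by the LOCAL `L¹ × L^∞` size
  have h1 : ⟪δv, v⟫_ℂ = (c₀ : ℂ) * ⟪w, w⟫_ℂ := inner_single_left b w δv v hδv
  have h2 : ‖⟪δv, v⟫_ℂ‖ = c₀ * ‖w‖ ^ 2 := by
    rw [h1, norm_mul, Complex.norm_real, Real.norm_eq_abs, abs_of_pos hc₀, inner_self_eq_norm_sq_to_K, norm_pow, RCLike.norm_ofReal, abs_norm]
  have hgb : ∀ b', ‖toAlg φ g b'‖ ≤ Mφ * ‖WL2.equiv ℂ (fun _ : Bond d Pd => c₀) W g b'‖ := fun b' => hφ _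
  have hloc : ∀ (x : TSite d Pd) (q : DirPair d),
      (‖star (toAlg φ δv) (x, q.1.1)‖ + ‖star (toAlg φ δv) (x, q.1.2)‖ + ‖star (toAlg φ δv) (shift q.1.1 x, q.1.2)‖ +
          ‖star (toAlg φ δv) (shift q.1.2 x, q.1.1)‖) *
          (‖toAlg φ g (x, q.1.1)‖ + ‖toAlg φ g (x, q.1.2)‖ + ‖toAlg φ g (shift q.1.1 x, q.1.2)‖ + ‖toAlg φ g (shift q.1.2 x, q.1.1)‖) ≤
        (‖star (toAlg φ δv) (x, q.1.1)‖ + ‖star (toAlg φ δv) (x, q.1.2)‖ + ‖star (toAlg φ δv) (shift q.1.1 x, q.1.2)‖ +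
          ‖star (toAlg φ δv) (shift q.1.2 x, q.1.1)‖) * (4 * (Mφ * M)) := by
    intro x q
    by_cases hb : b = (x, q.1.1) ∨ b = (x, q.1.2) ∨ b = (shift q.1.1 x, q.1.2) ∨ b = (shift q.1.2 x, q.1.1)
    · refine mul_le_mul_of_nonneg_left ?_ (by positivity)
      have h := mul_le_mul_of_nonneg_left (hM x q hb) hMφ
      linarith [hgb (x, q.1.1), hgb (x, q.1.2), hgb (shift q.1.1 x, q.1.2), hgb (shift q.1.2 x, q.1.1)]
    · simp only [not_or] at hb
      obtain ⟨n1, n2, n3, n4⟩ := hb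
      rw [star_toAlg_single_eq_zero φ b w δv hδv (Ne.symm n1), star_toAlg_single_eq_zero φ b w δv hδv (Ne.symm n2),
        star_toAlg_single_eq_zero φ b w δv hδv (Ne.symm n3), star_toAlg_single_eq_zero φ b w δv hδv (Ne.symm n4), norm_zero]
      simp
  have h3 : ‖⟪δv, v⟫_ℂ‖ ≤ K * (4 * Fintype.card (DirPair d) * (Mφ * ‖w‖)) * (4 * (Mφ * M)) := by
    rw [hv, inner_curvOp]
    have h := norm_curvForm_le_l1_linf_local τ hτ hMτ η U hU hδ hRe hIm (star (toAlg φ δv)) (toAlg φ g) (mul_nonneg hMφ hM0) hloc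
    have hD0 : (0 : ℝ) ≤ 4 * Fintype.card (DirPair d) := by positivity
    have h' := mul_le_mul_of_nonneg_right (mul_le_mul_of_nonneg_left (mul_le_mul_of_nonneg_left
      (sum_norm_star_toAlg_single_le φ hφ hstar b w δv hδv) hD0) hK0) (by positivity : (0 : ℝ) ≤ 4 * (Mφ * M))
    exact h.trans h'
  -- divide by `c₀‖w‖`
  have h4 : c₀ * ‖w‖ ^ 2 ≤ (K * (16 * Fintype.card (DirPair d) * Mφ ^ 2) * M) * ‖w‖ := by
    rw [← h2]; exact h3.trans (le_of_eq (by ring))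
  have hC0 : 0 ≤ K * (16 * Fintype.card (DirPair d) * Mφ ^ 2) * M := by positivity
  have h5 : ‖w‖ ≤ (K * (16 * Fintype.card (DirPair d) * Mφ ^ 2) * M) / c₀ := by
    rw [le_div_iff₀ hc₀]
    by_cases h0 : ‖w‖ = 0
    · rw [h0, zero_mul]; exact hC0
    · have hpos : 0 < ‖w‖ := lt_of_le_of_ne (norm_nonneg _) (Ne.symm h0)
      have : (‖w‖ * c₀) * ‖w‖ ≤ (K * (16 * Fintype.card (DirPair d) * Mφ ^ 2) * M) * ‖w‖ :=
        calc (‖w‖ * c₀) * ‖w‖ = c₀ * ‖w‖ ^ 2 := by ring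
          _ ≤ _ := h4
      exact le_of_mul_le_mul_right this hpos
  refine h5.trans (le_of_eq ?_)
  rw [hK, div_eq_mul_inv, div_eq_mul_inv]; ring

include hφ hMφ hstar hτ hMτ hU hδ hRe hIm in
/-- **THE `L^∞ → L^∞` LETTER OF `Δ′`: `‖(Δ′g)(b)‖ ≤ p_K·⨆_{b′}‖g(b′)‖`**, `p_K = 768·|DirPair d|·M_τ·M_φ²·(‖η^d‖∕c₀)·‖η⁻¹‖²·δ` — the global reading of
`norm_apply_curvOp_le_local`; EXACTLY the `hPΔ` hypothesis of `B9Eq326LocalPartSupBound.norm_localInv_apply_le` with `pΔ := p_K` (= the `L²` size of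
`B9Eq369CurvFormL2`); on print's class (3.35) (`δ = O(α₀η²)`, `c₀ = η^d`) `p_K = O(α₀)` — (3.69) in the VALUE currency.
[cite: Balaban1985BackgroundPropagators, (3.69) p.404, (3.10) p.392, (3.11) p.392, (3.35) p.396] -/
theorem norm_apply_curvOp_le_sup (g : BondL2K ℂ d Pd c₀ W) (b : Bond d Pd) :
    ‖WL2.equiv ℂ (fun _ : Bond d Pd => c₀) W (curvOp φ τ η U g) b‖ ≤
      768 * Fintype.card (DirPair d) * Mτ * Mφ ^ 2 * (‖((η : ℂ)) ^ d‖ / c₀) * ‖((η : ℂ))⁻¹‖ ^ 2 * δ *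
        ⨆ b' : Bond d Pd, ‖WL2.equiv ℂ (fun _ : Bond d Pd => c₀) W g b'‖ := by
  have hle : ∀ b', ‖WL2.equiv ℂ (fun _ : Bond d Pd => c₀) W g b'‖ ≤ ⨆ b' : Bond d Pd, ‖WL2.equiv ℂ (fun _ : Bond d Pd => c₀) W g b'‖ :=
    le_ciSup (f := fun b' : Bond d Pd => ‖WL2.equiv ℂ (fun _ : Bond d Pd => c₀) W g b'‖) (Set.finite_range _).bddAbove
  exact norm_apply_curvOp_le_local φ hφ hMφ hstar τ hτ hMτ η U hU hδ hRe hIm g b (Real.iSup_nonneg fun b' => norm_nonneg _)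
    fun x q _ => by linarith [hle (x, q.1.1), hle (x, q.1.2), hle (shift q.1.1 x, q.1.2), hle (shift q.1.2 x, q.1.1)]

end L2

end Literature.MathematicalPhysics.QuantumFieldTheory.Balaban1983to89.B9Eq369CurvOpSupLetter

end
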